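import Summits.ResolutionOfSingularities.ResolutionOfSingularities.Theses.UniversalCells
import Summits.ResolutionOfSingularities.ResolutionOfSingularities.Theorems.UniversalCellsDefs
import Summits.ResolutionOfSingularities.ResolutionOfSingularities.Theorems.UniversalCellsUniversalityAffinePresentation
import Summits.ResolutionOfSingularities.ResolutionOfSingularities.Theorems.UniversalCellsUniversalityStratumReindex
import Summits.ResolutionOfSingularities.ResolutionOfSingularities.Theorems.UniversalCellsUniversalityFlattening
import Summits.ResolutionOfSingularities.ResolutionOfSingularities.Theorems.UniversalCellsUniversalityTorusSplitting
import Summits.ResolutionOfSingularities.ResolutionOfSingularities.Theorems.UniversalCellsUniversalityChartGlobalisation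
import Summits.ResolutionOfSingularities.ResolutionOfSingularities.Theorems.UniversalCellsUniversalityNormalizedEncoding
import HarnessLib

/-!
# Crux `Universality` (stmt-ResolutionOfSingularities-15234) — line `birth`, lead's reshaped skeleton

Route `ResolutionOfSingularities/UniversalCells`, crux #7 (rank 7, known theorem):
`Universality` = "MNËV–LAFFORGUE–LEE–VAKIL UNIVERSALITY, matrix form over the prime field: for
`Y` integral, separated and of finite type over `Spec 𝔽_p` and `y ∈ Y` there are `m, Γ₊, Γ₀, s`, a
scheme `W` with an open immersion `j : W ⟶ 𝔸ˢ_Y` and an open immersion `i` into the partial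
matroid stratum `P(p, m, Γ₊, Γ₀) = Spec ((𝔽_p[a_ij : 3 × m] ⧸ ⟨3 × 3 minors of [I₃ | A] in Γ₀⟩)
[1 / ∏_{Γ₊} minors])`, `W` integral, and `w ∈ W` over `y`."

## The cut (birth skeleton of planner-skel-…-15234-0, load-bearing stub reshaped by the lead)

The birth skeleton's three moves are kept verbatim as STATEMENTS (`Sig.stub_elementaryChart`,
`Sig.stub_matroidEncoding`, `Sig.stub_chartGlobalisation`) and its PROVED assembly
`Universality_of` is untouched. The lead's observation (PICKED.md): the crux quantifies over PARTIAL
strata — `Γ₀` is an arbitrary set and `Γ₊` an arbitrary finite set of column triples, with no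
covering condition — so the von Staudt encoding may impose EXACTLY the minors it wants and invert
EXACTLY the designated homogeneous coordinates; none of the genericity bookkeeping of genuine matroid
strata (all incidences controlled, ≥ 3 points per line, the characteristic-2 coincidences of
Lee–Vakil §5) is needed, and every determined coordinate of the configuration below has leading
coefficient `±1` (no division by values). Accordingly `stub_matroidEncoding` is no longer a stub but
is PROVED (`matroidEncoding_of`) from three registered stubs:

* `stub_stratumReindex` (TRUE, size M — Mathlib plumbing). The stratum ring is defined verbatim for
  an arbitrary finite column index type `κ` (`StratumRing'`); a bijection `κ ≃ Fin m` transports it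
  to the crux's `StratumRing p m` (`MvPolynomial.renameEquiv`, `Ideal.map_span`,
  `Ideal.quotientEquiv`, `IsLocalization.ringEquivOfRingEquiv`).
* `stub_torusSplitting` (TRUE, size L — Gelfand–MacPherson for the affine chart, configuration
  independent). For `κ = Unit ⊕ κ'` (the `Unit` column is the fourth frame point `(1:1:1)`),
  designated rows `d : κ' → Fin 3` and ANY set `Γ₀` of column triples, with `Γ₊ :=` the selectors of
  the three frame entries and of the designated entries `a_{d c, c}` (each such entry is, up to sign,
  the `3 × 3` minor of `[I₃ | A]` on the two complementary identity columns and the column itself):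
  `S(κ, Γ₊, Γ₀) ≃+* NormRing[λ₁^±, λ₂^±, λ₃^±, μ_c^± (c ∈ κ')]`, where
  `NormRing = 𝔽_p[n_{ic}] ⧸ ⟨n_{d c, c} − 1, Γ₀-minors of the NORMALISED matrix [I₃ | 𝟙 | (n_{ic})]⟩`.
  The maps: `a_{i,F} ↦ λ_i`, `a_{ic} ↦ λ_i μ_c n_{ic}`; inversely `λ_i ↦ a_{iF}`,
  `μ_c ↦ a_{dc,c} a_{dc,F}⁻¹`, `n_{ic} ↦ a_{ic} a_{iF}⁻¹ μ_c⁻¹`; minors correspond up to the units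
  `det D_λ · ∏_j scale(u_j)` because `[I₃ | A] = D_λ · [I₃ | 𝟙 | n] · diag(λ⁻¹ ⊕ 1 ⊕ μ)` columnwise.
* `stub_normalizedEncoding` (THE HEART, lead's own — von Staudt with `±1` pivots, size L). For the
  explicit configuration `config N Eadd Emul Eone` on the column set `Kol N` (constants
  `C1 = (1:1:0)`, `D1 = (1:0:1)`, `X = (0:−1:1)`; value columns `V_i = (x_i:1:0)`; per triple
  `r = (i,j,k)` an addition gadget `Qa_r = (x_j:0:1)`, `H_r = (x_i+x_j:1:1)` and a multiplication
  gadget `Qm_r = (x_j:0:1)`, `R_r = (0:−x_j:1)`, `Q'_r = (x_i x_j:0:1)`; the final incidences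
  `det(e₃, V_k, H_r) = x_k − x_i − x_j` for `r ∈ Eadd`, `det(X, V_k, Q'_r) = x_k − x_i x_j` for
  `r ∈ Emul`, `det(e₃, F, V_i) = 1 − x_i` for `i ∈ Eone`):
  `NormRing(Kol N, dRow, config) ≃+* ElemRing p N Eadd Emul Eone`.
* `matroidEncoding_of` (PROVED): `m := card (Unit ⊕ Kol N)`, transport along `Fintype.equivFin`,
  `s := m + 2`… precisely `s := card (Fin 3 ⊕ Kol N)`, `g := ∏ X_t` (a monomial, hence outside
  `𝔮·B[t]` for `𝔮 ≠ ⊤` by `MvPolynomial.mem_map_C_iff`), `h := 1`.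

The two outer stubs are as filed at birth:

* `stub_elementaryChart` (TRUE, size M–L): affine open, finite presentation over the Noetherian
  `ZMod p`, flattening of the presentation into elementary relations.
* `stub_chartGlobalisation` (TRUE, size L): scheme plumbing from the ring-level chart.

Transfer (declared): unchanged from birth — `Sig.stub_matroidEncoding` is the crux in ring form C⁺;
it is now itself decomposed as reindex ∘ torus splitting ∘ normalised encoding, all three TRUE.

Disproof used: none on file for this crux (`ledger crux ls`: no `Disproof.lean`, no Negative lemmas,
2026-08-17). Dead lines: none.
-/

noncomputable section

-- single-problem summit: the doubled namespace component `ResolutionOfSingularities` is forced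
set_option linter.dupNamespace false

open CategoryTheory AlgebraicGeometry
open Summit.ResolutionOfSingularities.ResolutionOfSingularities.Theses.UniversalCells (Universality)

namespace Summit.ResolutionOfSingularities.ResolutionOfSingularities.Cruxes.Universality.Lines.Birth

/-! ## The objects of the cut

All abbreviations (`tautMatrix`, `minorIdeal`, `StratumRing`, `elemIdeal`, `ElemRing`, `tautMatrix'`,
`minor'`, `StratumRing'`, `entrySel`, `designatedSels`, `normMatrix`, `normMinor`, `normIdeal`,
`NormRing`, `TorusRing`, `Kol`, `dRow`, `colF … colM`, `config`) now live in the TREE, in the route's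
shared definitions file `Theorems/UniversalCellsDefs.lean` (p147700, accepted 2026-08-17T07:58Z,
namespace `Summit.ResolutionOfSingularities.ResolutionOfSingularities.Theorems.UniversalCells`), which
also proves the definitional glue stub `stub_stratumRingDefs` (`StratumRing p m = StratumRing' p (Fin m)`
by `rfl`). They are opened here so that the registered stub signatures below read verbatim. -/

open Summit.ResolutionOfSingularities.ResolutionOfSingularities.Theorems.UniversalCells

example (p m : ℕ) (Γp : Finset (Fin 3 → Fin 3 ⊕ Fin m)) (Γ0 : Set (Fin 3 → Fin 3 ⊕ Fin m)) :
    StratumRing p m Γp Γ0 = StratumRing' p (Fin m) Γp Γ0 :=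
  stub_stratumRingDefs p m Γp Γ0

/-! ## The stub STATEMENTS by name (`Sig.stub_<name>`) -/

/-- Statement of `stub_elementaryChart` — ELEMENTARY AFFINE CHARTS: every point of a scheme locally
of finite type over `Spec (ZMod p)` lies in an affine open whose coordinate ring has an elementary
presentation. [cite: LeeVakil2012, §2 Strategy (a) and eq. (e:fg)] -/
def Sig.stub_elementaryChart : Prop :=
  ∀ (p : ℕ), p.Prime → ∀ (Y : Scheme.{0}) (f : Y ⟶ Spec (.of (ZMod p))), LocallyOfFiniteType f →
    ∀ y : Y, ∃ U : Y.Opens, IsAffineOpen U ∧ y ∈ U ∧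
      ∃ (N : ℕ) (Eadd Emul : Finset (Fin N × Fin N × Fin N)) (Eone : Finset (Fin N)),
        Nonempty (Γ(Y, U) ≃+* ElemRing p N Eadd Emul Eone)

/-- Statement of `stub_affinePresentation` — AFFINE CHARTS OF FINITE PRESENTATION: every point of a
scheme locally of finite type over `Spec (ZMod p)` lies in an affine open whose coordinate ring is
`(ZMod p)[x_1, …, x_n] ⧸ ⟨S⟩` for a finite set `S` of polynomials. [cite: StacksProject, Tag 01TO
(locally of finite type), Tag 00FP (finite type over Noetherian is finite presentation)] -/
def Sig.stub_affinePresentation : Prop :=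
  ∀ (p : ℕ), p.Prime → ∀ (Y : Scheme.{0}) (f : Y ⟶ Spec (.of (ZMod p))), LocallyOfFiniteType f →
    ∀ y : Y, ∃ U : Y.Opens, IsAffineOpen U ∧ y ∈ U ∧
      ∃ (n : ℕ) (S : Finset (MvPolynomial (Fin n) (ZMod p))),
        Nonempty (Γ(Y, U) ≃+* MvPolynomial (Fin n) (ZMod p) ⧸
          Ideal.span (↑S : Set (MvPolynomial (Fin n) (ZMod p))))

/-- Statement of `stub_flattening` — FLATTENING A FINITE PRESENTATION INTO ELEMENTARY RELATIONS
("simple equations", Lee–Vakil p. 5): `(ZMod p)[x] ⧸ ⟨S⟩ ≃+* ElemRing p N E` for suitable elementary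
data. [cite: LeeVakil2012, §2 eq. (e:fg)] -/
def Sig.stub_flattening : Prop :=
  ∀ (p : ℕ), p.Prime → ∀ (n : ℕ) (S : Finset (MvPolynomial (Fin n) (ZMod p))),
    ∃ (N : ℕ) (Eadd Emul : Finset (Fin N × Fin N × Fin N)) (Eone : Finset (Fin N)),
      Nonempty ((MvPolynomial (Fin n) (ZMod p) ⧸ Ideal.span (↑S : Set (MvPolynomial (Fin n) (ZMod p))))
        ≃+* ElemRing p N Eadd Emul Eone)

/-- Statement of `stub_matroidEncoding` (birth; now PROVED below from three stubs) — VON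
STAUDT–MNËV ENCODING, RING FORM: a basic open of affine space over an elementary ring, through any
prescribed prime, is a basic open of a partial matroid stratum of `3 × (3+m)` matrices over `𝔽_p`.
[cite: LeeVakil2012, Thm. 1.1 and §2 Strategy (b)(c); Lafforgue2003, Thm. I.11, I.14; Hu2021,
Thms. 9.3–9.4; Mnev1988] -/
def Sig.stub_matroidEncoding : Prop :=
  ∀ p : ℕ, p.Prime → ∀ (N : ℕ) (Eadd Emul : Finset (Fin N × Fin N × Fin N)) (Eone : Finset (Fin N))
    (𝔮 : Ideal (ElemRing p N Eadd Emul Eone)), 𝔮.IsPrime →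
    ∃ (m : ℕ) (Γp : Finset (Fin 3 → Fin 3 ⊕ Fin m)) (Γ0 : Set (Fin 3 → Fin 3 ⊕ Fin m)) (s : ℕ)
      (g : MvPolynomial (Fin s) (ElemRing p N Eadd Emul Eone)) (h : StratumRing p m Γp Γ0),
      g ∉ Ideal.map (MvPolynomial.C : ElemRing p N Eadd Emul Eone →+* _) 𝔮 ∧
        Nonempty (Localization.Away g ≃+* Localization.Away h)

/-- Statement of `stub_chartGlobalisation` — CHART GLOBALISATION: ring-level chart data at an
affine open `U ∋ y` of an integral scheme `Y` yield the crux's open immersions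
`W ⟶ 𝔸ˢ_Y`, `W ⟶ Spec S(p, m, Γ₊, Γ₀)` with `W` integral and a point of `W` over `y`.
[cite: StacksProject, Tag 01IZ, Tag 01JJ; LeeVakil2012, §2 Strategy (b)] -/
def Sig.stub_chartGlobalisation : Prop :=
  ∀ (p : ℕ) (Y : Scheme.{0}), IsIntegral Y → ∀ (y : Y) (U : Y.Opens) (hU : IsAffineOpen U)
    (hy : y ∈ U) (B : Type) [CommRing B] (e : Γ(Y, U) ≃+* B)
    (m : ℕ) (Γp : Finset (Fin 3 → Fin 3 ⊕ Fin m)) (Γ0 : Set (Fin 3 → Fin 3 ⊕ Fin m)) (s : ℕ)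
    (g : MvPolynomial (Fin s) B) (h : StratumRing p m Γp Γ0),
    g ∉ Ideal.map (MvPolynomial.C : B →+* _) (Ideal.map e (hU.primeIdealOf ⟨y, hy⟩).asIdeal) →
    (Localization.Away g ≃+* Localization.Away h) →
    ∃ (W : Scheme.{0}) (j : W ⟶ 𝔸(Fin s; Y)) (w : W)
      (i : W ⟶ Spec (.of (StratumRing p m Γp Γ0))),
      IsOpenImmersion j ∧ IsOpenImmersion i ∧ IsIntegral W ∧
        (CategoryTheory.over (𝔸(Fin s; Y)) Y).base (j.base w) = y

/-- Statement of `stub_stratumReindex` — the partial stratum ring does not depend on the names of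
the columns: a bijection `κ ≃ Fin m` transports `StratumRing' p κ` to the crux's `StratumRing p m`.
[folklore] -/
def Sig.stub_stratumReindex : Prop :=
  ∀ (p : ℕ) (κ : Type) [Fintype κ] [DecidableEq κ] (m : ℕ) (e : κ ≃ Fin m)
    (Γp : Finset (Fin 3 → Fin 3 ⊕ κ)) (Γ0 : Set (Fin 3 → Fin 3 ⊕ κ)),
    Nonempty (StratumRing' p κ Γp Γ0 ≃+*
      StratumRing p m (Γp.image fun u => Sum.map id e ∘ u) ((fun u => Sum.map id e ∘ u) '' Γ0))

/-- Statement of `stub_torusSplitting` — GELFAND–MACPHERSON TORUS SPLITTING for the affine chart: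
with the frame entries and one designated entry per column inverted, the partial stratum ring is the
ring of Laurent polynomials in `3 + #κ'` torus coordinates over the normalised stratum ring.
[cite: Hu2021, Thm. 9.3 and p. 64; Lafforgue2003, Thm. I.11] -/
def Sig.stub_torusSplitting : Prop :=
  ∀ (p : ℕ) (κ' : Type) [Fintype κ'] [DecidableEq κ'] (d : κ' → Fin 3)
    (Γ0 : Set (Fin 3 → Fin 3 ⊕ (Unit ⊕ κ'))),
    Nonempty (StratumRing' p (Unit ⊕ κ') (designatedSels κ' d) Γ0 ≃+*
      TorusRing (Fin 3 ⊕ κ') (NormRing p κ' d Γ0))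

/-- Statement of `stub_normalizedEncoding` — VON STAUDT ENCODING WITH UNIT PIVOTS: the normalised
stratum ring of the configuration of an elementary presentation IS the elementary ring.
[cite: LeeVakil2012, Thm. 1.1, §3; Mnev1988] -/
def Sig.stub_normalizedEncoding : Prop :=
  ∀ (p N : ℕ) (Eadd Emul : Finset (Fin N × Fin N × Fin N)) (Eone : Finset (Fin N)),
    Nonempty (NormRing p (Kol N) (dRow N) (config N Eadd Emul Eone) ≃+* ElemRing p N Eadd Emul Eone)

/-! ## The stubs -/

/-- **STUB (true, size M).** AFFINE CHARTS OF FINITE PRESENTATION: for `Y` locally of finite type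
over `Spec (ZMod p)` (`p` prime) and `y ∈ Y` there is an affine open `U ∋ y` with
`Γ(Y, U) ≃+* (ZMod p)[x_1, …, x_n] ⧸ ⟨S⟩`, `S` finite. Paper proof: affine opens form a basis
(`Opens.isBasis_iff_nbhd` / `isBasis_affine_open`); for an affine open `U` of `Y` over the affine base,
`LocallyOfFiniteType` gives `RingHom.FiniteType` of `Γ(Spec 𝔽_p, ⊤) → Γ(Y, U)`
(`HasRingHomProperty.appLE`), i.e. `Γ(Y, U)` is a finitely generated `ZMod p`-algebra (any algebra
structure: ring maps out of `ZMod p` are unique), hence finitely presented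
(`Algebra.FinitePresentation.of_finiteType`, `ZMod p` a field), i.e. a quotient of a polynomial ring
by a finitely generated ideal (`Ideal.quotientKerAlgEquivOfSurjective`, `Ideal.FG`).
[cite: StacksProject, Tag 01TO, Tag 00FP] -/
theorem stub_affinePresentation (p : ℕ) (hp : p.Prime) (Y : Scheme.{0})
    (f : Y ⟶ Spec (.of (ZMod p))) (hf : LocallyOfFiniteType f) (y : Y) :
    ∃ U : Y.Opens, IsAffineOpen U ∧ y ∈ U ∧
      ∃ (n : ℕ) (S : Finset (MvPolynomial (Fin n) (ZMod p))),
        Nonempty (Γ(Y, U) ≃+* MvPolynomial (Fin n) (ZMod p) ⧸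
          Ideal.span (↑S : Set (MvPolynomial (Fin n) (ZMod p)))) :=
  -- LANDED: p148740 (worker, wave 1) Theorems/UniversalCellsUniversalityAffinePresentation.lean
  Summit.ResolutionOfSingularities.ResolutionOfSingularities.Theorems.UniversalCells.stub_affinePresentation p hp Y f hf y

/-- **STUB (true, size L).** FLATTENING: every finite presentation `(ZMod p)[x_1..x_n] ⧸ ⟨S⟩` is
isomorphic to an elementary ring `ElemRing p N Eadd Emul Eone` (relations `x_i + x_j = x_k`,
`x_i x_j = x_k`, `x_i = 1` only). Paper proof (Lee–Vakil eq. (e:fg), made uniform): take as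
generators `g_m` for all monomials `m ≤ M` (`M` = the sum of all monomials occurring in `S` and all
degree-one monomials; a finite down-set), constants `k_c (c ∈ ZMod p)`, terms `t_{f,m}` and partial
sums `s_{f,i}` for `f ∈ S`; relations `g_0 = 1`, `g_m = g_{m−e_k} · g_{e_k}`, `k_0 = k_0 + k_0 − k_0`,
`k_{c+1} = k_c + g_0`, `t_{f,m} = k_{coeff_m f} · g_m`, `s_{f,0} = 0`, `s_{f,i+1} = s_{f,i} + t_{f,mᵢ}`,
`s_{f,last} = 0`; the maps `x_k ↦ g_{e_k}` and `generator ↦ its value` are inverse because every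
generator is provably (from the relations) the corresponding polynomial in the `g_{e_k}`.
[cite: LeeVakil2012, §2 eq. (e:fg)] -/
theorem stub_flattening (p : ℕ) (hp : p.Prime) (n : ℕ)
    (S : Finset (MvPolynomial (Fin n) (ZMod p))) :
    ∃ (N : ℕ) (Eadd Emul : Finset (Fin N × Fin N × Fin N)) (Eone : Finset (Fin N)),
      Nonempty ((MvPolynomial (Fin n) (ZMod p) ⧸
        Ideal.span (↑S : Set (MvPolynomial (Fin n) (ZMod p)))) ≃+* ElemRing p N Eadd Emul Eone) :=
  -- LANDED: p149553 (worker, wave 1) Theorems/UniversalCellsUniversalityFlattening.lean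
  Summit.ResolutionOfSingularities.ResolutionOfSingularities.Theorems.UniversalCells.stub_flattening p hp n S

/-- **STUB (true, size L).** CHART GLOBALISATION: `Y` integral, `U ∋ y` affine open,
`e : Γ(Y, U) ≃+* B`, `g ∈ B[t_1, …, t_s]` outside the extension of `e(𝔭_y)`, and a ring
isomorphism `B[t][1/g] ≃+* S(p, m, Γ₊, Γ₀)[1/h]` give `W := Spec B[t][1/g]` with an open immersion
`j : W ⟶ 𝔸ˢ_Y`, an open immersion `i : W ≅ Spec S[1/h] ⟶ Spec S`, `W` integral, and the point
`w = (𝔭_y B[t])[1/g]` with `(𝔸ˢ_Y → Y) (j w) = y`. [cite: StacksProject, Tag 01IZ, Tag 01JJ;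
LeeVakil2012, §2 (b)] -/
theorem stub_chartGlobalisation (p : ℕ) (Y : Scheme.{0}) (hY : IsIntegral Y) (y : Y)
    (U : Y.Opens) (hU : IsAffineOpen U) (hy : y ∈ U) (B : Type) [CommRing B]
    (e : Γ(Y, U) ≃+* B) (m : ℕ) (Γp : Finset (Fin 3 → Fin 3 ⊕ Fin m))
    (Γ0 : Set (Fin 3 → Fin 3 ⊕ Fin m)) (s : ℕ) (g : MvPolynomial (Fin s) B)
    (h : StratumRing p m Γp Γ0)
    (hg : g ∉ Ideal.map (MvPolynomial.C : B →+* _) (Ideal.map e (hU.primeIdealOf ⟨y, hy⟩).asIdeal))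
    (echart : Localization.Away g ≃+* Localization.Away h) :
    ∃ (W : Scheme.{0}) (j : W ⟶ 𝔸(Fin s; Y)) (w : W)
      (i : W ⟶ Spec (.of (StratumRing p m Γp Γ0))),
      IsOpenImmersion j ∧ IsOpenImmersion i ∧ IsIntegral W ∧
        (CategoryTheory.over (𝔸(Fin s; Y)) Y).base (j.base w) = y :=
  -- LANDED: p149912 (worker, wave 1) Theorems/UniversalCellsUniversalityChartGlobalisation.lean
  Summit.ResolutionOfSingularities.ResolutionOfSingularities.Theorems.UniversalCells.stub_chartGlobalisation p Y hY y U hU hy B e m Γp Γ0 s g h hg echart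

/-- **STUB (true, size M).** REINDEXING THE COLUMNS: transport of the partial stratum ring along a
bijection `κ ≃ Fin m` of column index types (rename the matrix variables, map the minor ideal and the
inverted product). [folklore] -/
theorem stub_stratumReindex (p : ℕ) (κ : Type) [Fintype κ] [DecidableEq κ] (m : ℕ)
    (e : κ ≃ Fin m) (Γp : Finset (Fin 3 → Fin 3 ⊕ κ)) (Γ0 : Set (Fin 3 → Fin 3 ⊕ κ)) :
    Nonempty (StratumRing' p κ Γp Γ0 ≃+*
      StratumRing p m (Γp.image fun u => Sum.map id e ∘ u) ((fun u => Sum.map id e ∘ u) '' Γ0)) :=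
  -- LANDED: p148813 (worker, wave 1) Theorems/UniversalCellsUniversalityStratumReindex.lean
  Summit.ResolutionOfSingularities.ResolutionOfSingularities.Theorems.UniversalCells.stub_stratumReindex p κ m e Γp Γ0

/-- **STUB (true, size L).** TORUS SPLITTING (Gelfand–MacPherson for the chart `p_123 ≠ 0`): see
`Sig.stub_torusSplitting`. Paper proof: `a_{iF} ↦ λ_i`, `a_{ic} ↦ λ_i μ_c n_{ic}` and inversely
`λ_i ↦ a_{iF}`, `μ_c ↦ a_{dc,c} / a_{dc,F}`, `n_{ic} ↦ a_{ic} a_{dc,F} / (a_{iF} a_{dc,c})`; the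
minors of `[I₃ | A] = D_λ [I₃ | 𝟙 | n] diag(λ⁻¹ ⊕ 1 ⊕ μ)` are unit multiples of those of
`[I₃ | 𝟙 | n]`, so both maps are well defined, and they are inverse on generators.
[cite: Hu2021, Thm. 9.3, p. 64; Lafforgue2003, Thm. I.11] -/
theorem stub_torusSplitting (p : ℕ) (κ' : Type) [Fintype κ'] [DecidableEq κ'] (d : κ' → Fin 3)
    (Γ0 : Set (Fin 3 → Fin 3 ⊕ (Unit ⊕ κ'))) :
    Nonempty (StratumRing' p (Unit ⊕ κ') (designatedSels κ' d) Γ0 ≃+*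
      TorusRing (Fin 3 ⊕ κ') (NormRing p κ' d Γ0)) :=
  -- LANDED: p149828 (worker, wave 1) Theorems/UniversalCellsUniversalityTorusSplitting.lean
  Summit.ResolutionOfSingularities.ResolutionOfSingularities.Theorems.UniversalCells.stub_torusSplitting p κ' d Γ0

/-- **STUB (the heart; lead's own, size L).** NORMALISED VON STAUDT ENCODING: see
`Sig.stub_normalizedEncoding`. Paper proof: `x_i ↦ n_{0,V_i}`; conversely every non-designated
entry of the configuration is forced by the imposed minors to be an explicit polynomial in the values
with pivot `±1` (`C1 = (1:1:0)`, `D1 = (1:0:1)`, `X = (0:−1:1)`, `Qa_r = (x_j:0:1)`,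
`H_r = (x_i+x_j:1:1)`, `Qm_r = (x_j:0:1)`, `R_r = (0:−x_j:1)`, `Q'_r = (x_i x_j:0:1)`), and the
final incidences are exactly the elementary relations (`det(e₃,V_k,H_r) = x_k − (x_i + x_j)`,
`det(X,V_k,Q'_r) = x_k − x_i x_j`, `det(e₃,F,V_i) = 1 − x_i`). [cite: LeeVakil2012, §3; Mnev1988] -/
theorem stub_normalizedEncoding (p N : ℕ) (Eadd Emul : Finset (Fin N × Fin N × Fin N))
    (Eone : Finset (Fin N)) :
    Nonempty (NormRing p (Kol N) (dRow N) (config N Eadd Emul Eone) ≃+*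
      ElemRing p N Eadd Emul Eone) :=
  -- LANDED: p150447 (lead) Theorems/UniversalCellsUniversalityNormalizedEncoding.lean (+ p149506)
  Summit.ResolutionOfSingularities.ResolutionOfSingularities.Theorems.UniversalCells.stub_normalizedEncoding p N Eadd Emul Eone

/-! ## Small glue lemmas (proved) -/

/-- Functoriality of `Localization.Away` along a ring isomorphism. [folklore] -/
lemma awayCongr {A A' : Type} [CommRing A] [CommRing A'] (e : A ≃+* A') (a : A) (a' : A')
    (h : e a = a') : Nonempty (Localization.Away a ≃+* Localization.Away a') :=
  ⟨IsLocalization.ringEquivOfRingEquiv (M := Submonoid.powers a) (T := Submonoid.powers a')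
    (Localization.Away a) (Localization.Away a') e
    (by rw [Submonoid.map_powers]; simp [h])⟩

/-- `TorusRing T` is functorial in the coefficient ring. [folklore] -/
lemma torusRingCongrRight (T : Type) [Fintype T] {R R' : Type} [CommRing R] [CommRing R']
    (e : R ≃+* R') : Nonempty (TorusRing T R ≃+* TorusRing T R') :=
  awayCongr (MvPolynomial.mapEquiv T e : MvPolynomial T R ≃+* MvPolynomial T R') _ _
    (by rw [map_prod]; simp [MvPolynomial.mapEquiv_apply])

/-- `TorusRing T R` only depends on `T` up to bijection. [folklore] -/
lemma torusRingCongrLeft {T T' : Type} [Fintype T] [Fintype T'] (R : Type) [CommRing R]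
    (eT : T ≃ T') : Nonempty (TorusRing T R ≃+* TorusRing T' R) :=
  awayCongr ((MvPolynomial.renameEquiv R eT : MvPolynomial T R ≃ₐ[R] MvPolynomial T' R) :
      MvPolynomial T R ≃+* MvPolynomial T' R)
    _ _ (by
      rw [map_prod]
      simp only [AlgEquiv.coe_ringEquiv, MvPolynomial.renameEquiv_apply, MvPolynomial.rename_X]
      exact Fintype.prod_equiv eT _ _ (fun _ => rfl))

/-- A product of variables lies outside `𝔮 · B[t]` for a prime `𝔮`. [folklore] -/
lemma prod_X_not_mem_map_C {B : Type} [CommRing B] (σ : Type) [Fintype σ] (𝔮 : Ideal B)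
    [𝔮.IsPrime] :
    (∏ t : σ, (MvPolynomial.X t : MvPolynomial σ B)) ∉
      Ideal.map (MvPolynomial.C : B →+* MvPolynomial σ B) 𝔮 := by
  intro hg
  have hker : (∏ t : σ, (MvPolynomial.X t : MvPolynomial σ B)) ∈
      RingHom.ker (MvPolynomial.map (σ := σ) (Ideal.Quotient.mk 𝔮)) := by
    rwa [MvPolynomial.ker_map, Ideal.mk_ker]
  rw [RingHom.mem_ker, map_prod] at hker
  simp only [MvPolynomial.map_X] at hker
  exact (Finset.prod_ne_zero_iff.mpr fun t _ => MvPolynomial.X_ne_zero (R := B ⧸ 𝔮) t) hker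

/-! ## The compositions (kernel-checked; no `sorry` in their own terms) -/

/-- `Sig.stub_matroidEncoding` from reindexing, torus splitting and the normalised encoding:
`S(Fin m) ≃ S(Unit ⊕ Kol N) ≃ NormRing[λ^±, μ^±] ≃ B[λ^±, μ^±] ≃ B[t_1..t_s][1/∏ t]`, with
`g := ∏ t` a monomial (outside `𝔮 B[t]`) and `h := 1`. [cite: LeeVakil2012, Thm. 1.1] -/
theorem matroidEncoding_of :
    Sig.stub_stratumReindex → Sig.stub_torusSplitting → Sig.stub_normalizedEncoding →
      Sig.stub_matroidEncoding := by
  intro hR hT hN p _hp N Eadd Emul Eone 𝔮 h𝔮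
  classical
  let m : ℕ := Fintype.card (Unit ⊕ Kol N)
  let e : Unit ⊕ Kol N ≃ Fin m := Fintype.equivFin _
  let s : ℕ := Fintype.card (Fin 3 ⊕ Kol N)
  let eT : Fin 3 ⊕ Kol N ≃ Fin s := Fintype.equivFin _
  obtain ⟨e1⟩ := hR p (Unit ⊕ Kol N) m e (designatedSels (Kol N) (dRow N))
    (config N Eadd Emul Eone)
  obtain ⟨e2⟩ := hT p (Kol N) (dRow N) (config N Eadd Emul Eone)
  obtain ⟨e3⟩ := hN p N Eadd Emul Eone
  obtain ⟨e4⟩ := torusRingCongrRight (Fin 3 ⊕ Kol N) e3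
  obtain ⟨e5⟩ := torusRingCongrLeft (ElemRing p N Eadd Emul Eone) eT
  refine ⟨m, (designatedSels (Kol N) (dRow N)).image fun u => Sum.map id e ∘ u,
    (fun u => Sum.map id e ∘ u) '' config N Eadd Emul Eone, s,
    ∏ t : Fin s, MvPolynomial.X t, 1, prod_X_not_mem_map_C (Fin s) 𝔮, ⟨?_⟩⟩
  have e6 := (IsLocalization.atOne
    (R := StratumRing p m ((designatedSels (Kol N) (dRow N)).image fun u => Sum.map id e ∘ u)
      ((fun u => Sum.map id e ∘ u) '' config N Eadd Emul Eone))
    (S := Localization.Away (1 : StratumRing p m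
      ((designatedSels (Kol N) (dRow N)).image fun u => Sum.map id e ∘ u)
      ((fun u => Sum.map id e ∘ u) '' config N Eadd Emul Eone)))).toRingEquiv
  exact e5.symm.trans (e4.symm.trans (e2.symm.trans (e1.trans e6)))

/-- `Sig.stub_elementaryChart` from an affine chart of finite presentation and flattening.
[cite: LeeVakil2012, §2 Strategy (a)] -/
theorem elementaryChart_of :
    Sig.stub_affinePresentation → Sig.stub_flattening → Sig.stub_elementaryChart := by
  intro hA hF p hp Y f hlft y
  obtain ⟨U, hU, hy, n, S, ⟨e₁⟩⟩ := hA p hp Y f hlft y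
  obtain ⟨N, Eadd, Emul, Eone, ⟨e₂⟩⟩ := hF p hp n S
  exact ⟨U, hU, hy, N, Eadd, Emul, Eone, ⟨e₁.trans e₂⟩⟩

/-- **`Universality` from the six stub statements** — the assembly, PROVED: at `y ∈ Y` take an
elementary affine chart `U ∋ y`, `e : Γ(Y, U) ≃+* B(p, N, E)` (`elementaryChart_of` the two presentation stubs); the prime
`𝔭_y = hU.primeIdealOf ⟨y, hy⟩` maps under `e` to a prime `𝔮` of the elementary ring
(`Ideal.map_isPrime_of_equiv`); the encoding (`matroidEncoding_of` the three algebraic stubs) gives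
the chart data `(m, Γ₊, Γ₀, s, g, h)` with `g ∉ 𝔮B[t]` and `B[t][1/g] ≃+* S[1/h]`; globalisation
(`stub_chartGlobalisation`) returns `W, j, w, i` — the crux's conclusion verbatim, the skeleton's
`StratumRing p m Γp Γ0` being the crux's `let`-bound stratum ring by `rfl`.
[cite: LeeVakil2012, Thm. 1.1, §2] -/
theorem Universality_of :
    Sig.stub_affinePresentation → Sig.stub_flattening → Sig.stub_stratumReindex →
      Sig.stub_torusSplitting → Sig.stub_normalizedEncoding → Sig.stub_chartGlobalisation →
        Universality := by
  intro hA hF hR hT hN hγ p hp Y f _hsep hlft _hqc hint y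
  have hα : Sig.stub_elementaryChart := elementaryChart_of hA hF
  have hβ : Sig.stub_matroidEncoding := matroidEncoding_of hR hT hN
  obtain ⟨U, hU, hy, N, Eadd, Emul, Eone, ⟨e⟩⟩ := hα p hp Y f hlft y
  have hprime : (Ideal.map e (hU.primeIdealOf ⟨y, hy⟩).asIdeal).IsPrime :=
    Ideal.map_isPrime_of_equiv e
  obtain ⟨m, Γp, Γ0, s, g, h, hg, ⟨echart⟩⟩ :=
    hβ p hp N Eadd Emul Eone (Ideal.map e (hU.primeIdealOf ⟨y, hy⟩).asIdeal) hprime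
  obtain ⟨W, j, w, i, hj, hi, hW, hwy⟩ :=
    hγ p Y hint y U hU hy (ElemRing p N Eadd Emul Eone) e m Γp Γ0 s g h hg echart
  exact ⟨m, Γp, Γ0, s, W, j, w, i, hj, hi, hW, hwy⟩

/-- **The crux `Universality`, assembled from the five registered stubs.** -/
theorem Universality_proof : Universality :=
  Universality_of stub_affinePresentation stub_flattening stub_stratumReindex stub_torusSplitting
    stub_normalizedEncoding stub_chartGlobalisation

end Summit.ResolutionOfSingularities.ResolutionOfSingularities.Cruxes.Universality.Lines.Birth

end
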